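import Literature.Topology.FourManifolds.BoxUnstableSet
import Literature.Topology.FourManifolds.SlabDynamics
import HarnessLib

/-!
# In a Milnor box of a slab flow the stable set is the plane `y⃗ = 0`, the unstable set the
# plane `x⃗ = 0`, and the left-hand disc down to the level `f(q) - r²` is the flat disc
# `{y⃗ = 0, |x⃗|² ≤ r²}` (Milnor 1965, Def. 3.9 with Def. 3.1 (2) and the proof of Thm. 3.14:
# "`D_L` is the disk `{(x⃗, y⃗) ∈ L_λ : |y⃗| = 0}`")

Topic `Literature/Topology/FourManifolds`; a brick for the fact seat
`provefact-Literature.Topology.FourManifolds.Cobordism.Milnor1965_exists_isolatedPair_middle`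
(one-slide step of the Basis Theorem 7.6 on a slab: the germs of the left-hand discs and of
the right-hand discs at a critical point, read in a Milnor box, are the two coordinate planes —
the input for the local charts of the spheres `S_L`, `S_R` in a level (Lemma 7.7) and for the
localisation of the classes `[D_L]` at the right-hand discs (proof of Thm. 7.6, PDF pp. 50–52)).

Milnor, *Lectures on the h-cobordism theorem* (1965).  Def. 3.1 (2) (PDF p. 12): about a
critical point `f = f(p) - |x⃗|² + |y⃗|²` and `ξ` has coordinates `(-x⃗, y⃗)`.  Def. 3.9
(PDF p. 16): the left-hand disc `D_L` is *"the union of the segments of these integral curves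
beginning in `S_L` and ending at `p`"*, the right-hand disc dually.  Proof of Thm. 3.14
(PDF p. 19), in the coordinates of Def. 3.1 with `V = f⁻¹(f(p) - 1)`: *"`D_L` is the disk
`{(x⃗, y⃗) ∈ L_λ : |y⃗| = 0}`"* and `S_L = {|x⃗| = 1, y⃗ = 0}`.

In the tree: a slab flow `θ` of a cobordism on `f⁻¹[a₀, a₁]` (`Cobordism.PreSlabFlow` /
`Cobordism.SlabFlow`, `SlabDynamics.lean`), a Milnor box `D` of the cut-off field about the
critical point `q` whose chart domain lies in the open slab `f⁻¹(a₀, a₁)` (as provided by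
`IsGradientLike.exists_milnorBox_source_subset`), the intrinsic stable / unstable sets
`stableSet ξ q`, `unstableSet ξ q` and discs `leftHandDisc`, `leftHandSphere`
(`HandleSpheres.lean`), and the flat disc `D.cylDisc r = {y⃗ = 0, |x⃗|² ≤ r²}`
(`LeftHandDiscRetractionBox.lean`).  Everything is proved:

* `PreSlabFlow.box_inter_stableSet_eq` — **`W^s(q) ∩ box = {y⃗ = 0} ∩ box`**, and
  `PreSlabFlow.box_inter_unstableSet_eq` — **`W^u(q) ∩ box = {x⃗ = 0} ∩ box`** (the box
  dynamics of `MilnorBoxDynamics.lean` / `BoxUnstableSet.lean` through the bridge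
  `PreSlabFlow.mem_(un)stableSet_iff_tendsto`); `box_inter_leftHandDisc_eq` for the disc down
  to any level `≤ a₀`;
* **`SlabFlow.leftHandDisc_eq_cylDisc`** — for `r² < ε²` and `a₀ ≤ f(q) - r²`, the left-hand
  disc of `q` down to the level `f(q) - r²` *is* the flat disc `{y⃗ = 0, |x⃗|² ≤ r²}` of the box
  (a trajectory going to `q` from the level `f(q) - r²` or above cannot have entered the box
  through the face `|x⃗|² = ε²`, where `f = f(q) - ε²`: backward exit lemma
  `MilnorBox.exists_backward_exit`), and `SlabFlow.leftHandSphere_eq` — the left-hand sphere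
  in that level is `{y⃗ = 0, |x⃗|² = r²}`;
* `MilnorBox.cylDisc_eq_image_pt` — the flat disc is the inverse-chart image of the model disc
  `{y⃗ = 0, |x⃗|² ≤ r²}`.

## References

* J. Milnor, *Lectures on the h-cobordism theorem*, notes by L. Siebenmann and J. Sondow,
  Princeton Mathematical Notes (1965): Def. 3.1 (PDF p. 12), Def. 3.9 (PDF p. 16), proofs of
  Thms. 3.12–3.14 (PDF pp. 18–20), proof of Thm. 7.6 (PDF pp. 50–52).  Held:
  `lit read book:milnornd-lectures-h-cobordism-theorem`. [MilnorHCobordism1965]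
-/

open scoped Manifold ContDiff Topology
open Set Function Filter Metric

noncomputable section

namespace Literature.Topology.FourManifolds

universe u

/-! ### The flat disc as an image of the model disc -/

section Model

variable {m : ℕ} {H : Type*} [TopologicalSpace H] {J : ModelWithCorners ℝ (EuclideanSpace ℝ (Fin m)) H}
  {M : Type u} [TopologicalSpace M] [ChartedSpace H M]
  {f : M → ℝ} {X : Π x : M, TangentSpace J x} {q : M}

namespace MilnorBox

/-- **The flat disc `{y⃗ = 0, |x⃗|² ≤ r²}` of a Milnor box is the inverse-chart image of the
model disc** (`r² ≤ ε²`). [cite: MilnorHCobordism1965, proof of Thm. 3.14 (PDF p. 19)] -/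
theorem cylDisc_eq_image_pt (D : MilnorBox J f X q) {r : ℝ} (hr : r ^ 2 ≤ D.ε ^ 2) :
    D.cylDisc r = D.pt '' {v | sqSumGE D.k v = 0 ∧ sqSumLT D.k v ≤ r ^ 2} := by
  have hε := D.eps_pos
  ext z
  constructor
  · rintro ⟨hz, hB, hA⟩
    exact ⟨D.coord z, ⟨hB, hA⟩, D.pt_coord hz⟩
  · rintro ⟨v, ⟨hB, hA⟩, rfl⟩
    have h₁ : sqSumLT D.k v ≤ D.ε ^ 2 := hA.trans hr
    have h₂ : sqSumGE D.k v ≤ 4 * D.ε ^ 2 := by rw [hB]; positivity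
    refine ⟨D.pt_mem_source h₁ h₂, ?_, ?_⟩
    · rw [D.coord_pt h₁ h₂]; exact hB
    · rw [D.coord_pt h₁ h₂]; exact hA

/-- A point of the flat disc of radius `r`, `r² < ε²`, lies in the (open) box. [folklore] -/
theorem mem_box_of_mem_cylDisc (D : MilnorBox J f X q) {r : ℝ} (hr : r ^ 2 < D.ε ^ 2) {z : M}
    (hz : z ∈ D.cylDisc r) : z ∈ D.box := by
  have hε := D.eps_pos
  refine ⟨hz.1, hz.2.2.trans_lt hr, ?_⟩
  rw [hz.2.1]; positivity

end MilnorBox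

end Model

/-! ### Stable and unstable sets of a slab flow inside a Milnor box -/

variable {n : ℕ} {M N : Type u} [TopologicalSpace M] [ChartedSpace (EuclideanSpace ℝ (Fin n)) M]
  [TopologicalSpace N] [ChartedSpace (EuclideanSpace ℝ (Fin n)) N]
  {c : Cobordism n M N} {f : c.W → ℝ} {ξ : Π x : c.W, TangentSpace (𝓡∂ (n + 1)) x}
  {a₀ a₁ : ℝ} {θ : ℝ × c.W → c.W}

namespace Cobordism

namespace PreSlabFlow

/-- A point on the orbit of a point going to `p` goes to `p`. [folklore] -/
theorem tendsto_atTop_apply (h : PreSlabFlow c f ξ a₀ a₁ θ) {p y : c.W}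
    (hy : Tendsto (fun t => θ (t, y)) atTop (𝓝 p)) (t₀ : ℝ) :
    Tendsto (fun t => θ (t, θ (t₀, y))) atTop (𝓝 p) := by
  have h1 := hy.comp (tendsto_atTop_add_const_right atTop t₀ tendsto_id)
  refine h1.congr fun s => ?_
  simp only [comp_apply, id_eq, h.isSmoothFlow.map_add]

/-- **In a Milnor box of the slab flow, the stable set of the critical point is the plane
`y⃗ = 0`** (Milnor 1965, Def. 3.1 (2) with Def. 3.9: the trajectories in the box going to the
critical point are those on `y⃗ = 0`).  The chart domain of the box is assumed to lie in the
open slab `f⁻¹(a₀, a₁)`, where the flow is that of `ξ`. [cite: MilnorHCobordism1965, Def. 3.1 (2) (PDF p. 12), Def. 3.9 (PDF p. 16), proof of Thm. 3.12 (PDF p. 18)] -/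
theorem box_inter_stableSet_eq (h : PreSlabFlow c f ξ a₀ a₁ θ) {q : c.W}
    (D : MilnorBox (𝓡∂ (n + 1)) f (slabField f ξ a₀ a₁) q)
    (hD : D.chart.source ⊆ f ⁻¹' Ioo a₀ a₁) :
    D.box ∩ stableSet (𝓡∂ (n + 1)) ξ q = D.box ∩ {y | sqSumGE D.k (D.coord y) = 0} := by
  have hflow : IsFlowOf (𝓡∂ (n + 1)) (slabField f ξ a₀ a₁) θ := h.isSmoothFlow.isFlowOf
  have hq : f q ∈ Ioo a₀ a₁ := hD D.mem_source
  ext y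
  constructor
  · rintro ⟨hy, hys⟩
    have hfy : f y ∈ Ioo a₀ a₁ := hD hy.1
    exact ⟨hy, D.sqSumGE_eq_zero_of_tendsto_atTop hflow h.monotone hy
      ((h.mem_stableSet_iff_tendsto hfy.1.le hq.2.le).1 hys)⟩
  · rintro ⟨hy, hB⟩
    have hfy : f y ∈ Ioo a₀ a₁ := hD hy.1
    exact ⟨hy, (h.mem_stableSet_iff_tendsto hfy.1.le hq.2.le).2
      (D.tendsto_atTop_of_sqSumGE_eq_zero hflow hy hB)⟩

/-- **In a Milnor box of the slab flow, the unstable set of the critical point is the plane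
`x⃗ = 0`.** [cite: MilnorHCobordism1965, Def. 3.1 (2) (PDF p. 12), Def. 3.9 (PDF p. 16), proof of Thm. 3.12 (PDF p. 18)] -/
theorem box_inter_unstableSet_eq (h : PreSlabFlow c f ξ a₀ a₁ θ) {q : c.W}
    (D : MilnorBox (𝓡∂ (n + 1)) f (slabField f ξ a₀ a₁) q)
    (hD : D.chart.source ⊆ f ⁻¹' Ioo a₀ a₁) :
    D.box ∩ unstableSet (𝓡∂ (n + 1)) ξ q = D.box ∩ {y | sqSumLT D.k (D.coord y) = 0} := by
  have hflow : IsFlowOf (𝓡∂ (n + 1)) (slabField f ξ a₀ a₁) θ := h.isSmoothFlow.isFlowOf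
  have hq : f q ∈ Ioo a₀ a₁ := hD D.mem_source
  ext y
  constructor
  · rintro ⟨hy, hyu⟩
    have hfy : f y ∈ Ioo a₀ a₁ := hD hy.1
    exact ⟨hy, D.sqSumLT_eq_zero_of_tendsto_atBot hflow h.monotone hy
      ((h.mem_unstableSet_iff_tendsto hfy.2.le hq.1.le).1 hyu)⟩
  · rintro ⟨hy, hA⟩
    have hfy : f y ∈ Ioo a₀ a₁ := hD hy.1
    exact ⟨hy, (h.mem_unstableSet_iff_tendsto hfy.2.le hq.1.le).2
      (D.tendsto_atBot_of_sqSumLT_eq_zero_of_mem_box hflow hy hA)⟩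

/-- **The trace on the box of the left-hand disc down to a level `≤ a₀` is the plane `y⃗ = 0`**
(the whole box lies above the level). [cite: MilnorHCobordism1965, Def. 3.9 (PDF p. 16), Def. 3.1 (2) (PDF p. 12)] -/
theorem box_inter_leftHandDisc_eq (h : PreSlabFlow c f ξ a₀ a₁ θ) {q : c.W}
    (D : MilnorBox (𝓡∂ (n + 1)) f (slabField f ξ a₀ a₁) q)
    (hD : D.chart.source ⊆ f ⁻¹' Ioo a₀ a₁) {t : ℝ} (ht : t ≤ a₀) :
    D.box ∩ leftHandDisc (𝓡∂ (n + 1)) f ξ q t = D.box ∩ {y | sqSumGE D.k (D.coord y) = 0} := by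
  rw [← h.box_inter_stableSet_eq D hD]
  ext y
  simp only [mem_inter_iff, mem_leftHandDisc_iff]
  exact ⟨fun hy => ⟨hy.1, hy.2.1⟩, fun hy => ⟨hy.1, hy.2, ht.trans (hD hy.1.1).1.le⟩⟩

/-- **The trace on the box of the right-hand disc up to a level `≥ a₁` is the plane `x⃗ = 0`.** [cite: MilnorHCobordism1965, Def. 3.9 (PDF p. 16), Def. 3.1 (2) (PDF p. 12)] -/
theorem box_inter_rightHandDisc_eq (h : PreSlabFlow c f ξ a₀ a₁ θ) {q : c.W}
    (D : MilnorBox (𝓡∂ (n + 1)) f (slabField f ξ a₀ a₁) q)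
    (hD : D.chart.source ⊆ f ⁻¹' Ioo a₀ a₁) {t : ℝ} (ht : a₁ ≤ t) :
    D.box ∩ rightHandDisc (𝓡∂ (n + 1)) f ξ q t = D.box ∩ {y | sqSumLT D.k (D.coord y) = 0} := by
  rw [← h.box_inter_unstableSet_eq D hD]
  ext y
  simp only [mem_inter_iff, mem_rightHandDisc_iff]
  exact ⟨fun hy => ⟨hy.1, hy.2.1⟩, fun hy => ⟨hy.1, hy.2, (hD hy.1.1).2.le.trans ht⟩⟩

end PreSlabFlow

namespace SlabFlow

/-- **The left-hand disc down to the level `f(q) - r²` is the flat disc `{y⃗ = 0, |x⃗|² ≤ r²}`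
of the Milnor box** (Milnor 1965, proof of Thm. 3.14: *"`D_L` is the disk
`{(x⃗, y⃗) ∈ L_λ : |y⃗| = 0}`"*, with `V = f⁻¹(f(p) - 1)`; here at the distance `r²`, `r² < ε²`,
below the critical value, and `a₀ ≤ f(q) - r²`).  A point of the stable set at or above the
level `f(q) - r²` flows into the box, where it is on `y⃗ = 0`; had it come from outside the box,
its trajectory would have entered through the face `|x⃗|² = ε²`, `y⃗ = 0`, where
`f = f(q) - ε² < f(q) - r²` — impossible since `f` increases along trajectories. [cite: MilnorHCobordism1965, proof of Thm. 3.14 (PDF p. 19), Def. 3.9 (PDF p. 16), Def. 3.1 (2) (PDF p. 12)] -/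
theorem leftHandDisc_eq_cylDisc (h : SlabFlow c f ξ a₀ a₁ θ) {q : c.W}
    (hq : IsMCriticalPt (𝓡∂ (n + 1)) f q) (D : MilnorBox (𝓡∂ (n + 1)) f (slabField f ξ a₀ a₁) q)
    (hD : D.chart.source ⊆ f ⁻¹' Ioo a₀ a₁) {r : ℝ} (hr : r ^ 2 < D.ε ^ 2)
    (har : a₀ ≤ f q - r ^ 2) :
    leftHandDisc (𝓡∂ (n + 1)) f ξ q (f q - r ^ 2) = D.cylDisc r := by
  have hflow : IsFlowOf (𝓡∂ (n + 1)) (slabField f ξ a₀ a₁) θ := h.isSmoothFlow.isFlowOf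
  have hε := D.eps_pos
  have hfq : f q ∈ Ioo a₀ a₁ := hD D.mem_source
  ext x
  constructor
  · rintro ⟨hxs, hfx⟩
    have hfx' : f q - r ^ 2 ≤ f x := hfx
    have ha₀x : a₀ ≤ f x := har.trans hfx'
    have hlim : Tendsto (fun t => θ (t, x)) atTop (𝓝 q) :=
      (h.mem_stableSet_iff_tendsto ha₀x hfq.2.le).1 hxs
    -- the orbit enters the box at some time `t₁ ≥ 0`
    obtain ⟨t₁, ht₁, hz⟩ := ((eventually_ge_atTop (0 : ℝ)).and
      (hlim.eventually (D.isOpen_box.mem_nhds D.mem_box_self))).exists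
    set z : c.W := θ (t₁, x) with hz_def
    have hxz : x = θ (-t₁, z) := (hflow.map_neg_map t₁ x).symm
    -- there it is on the plane `y⃗ = 0`
    have hBz : sqSumGE D.k (D.coord z) = 0 :=
      D.sqSumGE_eq_zero_of_tendsto_atTop hflow h.monotone hz (h.tendsto_atTop_apply hlim t₁)
    rcases (sqSumLT_nonneg D.k (D.coord z)).eq_or_lt with hAz | hAz
    · -- `z` is the centre, a fixed point: `x = q`
      have hzq : z = q := D.eq_of_sqSum_eq_zero hz.1 hAz.symm hBz
      have hξq : slabField f ξ a₀ a₁ q = 0 := by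
        rw [slabField_apply, h.isGradientLike.apply_eq_zero_of_isMCriticalPt hq, smul_zero]
      have hxq : x = q := by
        rw [hxz, hzq]
        exact h.isSmoothFlow.apply_eq_self_of_apply_eq_zero h.contMDiff_one_slabField hξq _
      rw [hxq]
      exact MilnorBox.mem_cylDisc_self
    · -- `z` entered the box through the face `|x⃗|² = ε²` at the time `t₁ - T`
      obtain ⟨T, hT0, hstay, hAexit, hcons⟩ := D.exists_backward_exit hflow hz hAz
      rcases le_or_gt t₁ T with ht₁T | ht₁T
      · -- `x` itself lies on the backward orbit segment inside the closed box
        have hxmem := hstay (-t₁) ⟨neg_le_neg ht₁T, by linarith⟩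
        rw [← hxz] at hxmem
        have hsrc : ∀ s ∈ Icc (-t₁) 0, θ (s, z) ∈ D.chart.source := fun s hs =>
          (hstay s ⟨(neg_le_neg ht₁T).trans hs.1, hs.2⟩).1
        have hexp := hflow.sqSumGE_coord_eq_exp D (by linarith : -t₁ ≤ 0) hsrc
        rw [hflow.map_zero, hBz, ← hxz] at hexp
        have hBx : sqSumGE D.k (D.coord x) = 0 := by
          rcases mul_eq_zero.1 hexp.symm with h0 | h0
          · exact absurd h0 (Real.exp_pos _).ne'
          · exact h0
        refine ⟨hxmem.1, hBx, ?_⟩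
        have := D.apply_eq_of_mem_source hxmem.1
        rw [hBx] at this
        linarith
      · -- otherwise `x` lies before the entry point, below the level `f(q) - ε²`
        exfalso
        have hw : θ (t₁ - T, x) = θ (-T, z) := by
          rw [hz_def, hflow.map_add]; ring_nf
        have hBw : sqSumGE D.k (D.coord (θ (-T, z))) = 0 := by
          have h0 : D.ε ^ 2 * sqSumGE D.k (D.coord (θ (-T, z))) = 0 := by
            rw [hcons, hBz, mul_zero]
          rcases mul_eq_zero.1 h0 with h1 | h1
          · exact absurd h1 (by positivity)
          · exact h1
        have hfw : f (θ (-T, z)) = f q - D.ε ^ 2 := by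
          rw [D.apply_eq_of_mem_source (hstay (-T) ⟨le_rfl, by linarith⟩).1, hAexit, hBw]
          ring
        have hmono : f x ≤ f (θ (t₁ - T, x)) := by
          have := h.monotone x (by linarith : (0 : ℝ) ≤ t₁ - T)
          simpa only [h.isSmoothFlow.map_zero] using this
        rw [hw, hfw] at hmono
        linarith
  · intro hx
    have hxb : x ∈ D.box := D.mem_box_of_mem_cylDisc hr hx
    have hfx : f x ∈ Ioo a₀ a₁ := hD hx.1
    refine ⟨(h.mem_stableSet_iff_tendsto hfx.1.le hfq.2.le).2
      (D.tendsto_atTop_of_sqSumGE_eq_zero hflow hxb hx.2.1), ?_⟩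
    show f q - r ^ 2 ≤ f x
    rw [D.apply_eq_of_mem_source hx.1, hx.2.1]
    linarith [hx.2.2]

/-- **The left-hand sphere in the level `f(q) - r²` is the round sphere `{y⃗ = 0, |x⃗|² = r²}`
of the box** (Milnor 1965, proof of Thm. 3.14: `S_L = {|x⃗| = 1, y⃗ = 0}` in `V = f⁻¹(f(p) - 1)`;
here `r² < ε²`, `a₀ ≤ f(q) - r²`). [cite: MilnorHCobordism1965, proof of Thm. 3.14 (PDF pp. 19–20), Def. 3.9 (PDF p. 16)] -/
theorem leftHandSphere_eq (h : SlabFlow c f ξ a₀ a₁ θ) {q : c.W}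
    (hq : IsMCriticalPt (𝓡∂ (n + 1)) f q) (D : MilnorBox (𝓡∂ (n + 1)) f (slabField f ξ a₀ a₁) q)
    (hD : D.chart.source ⊆ f ⁻¹' Ioo a₀ a₁) {r : ℝ} (hr : r ^ 2 < D.ε ^ 2)
    (har : a₀ ≤ f q - r ^ 2) :
    leftHandSphere (𝓡∂ (n + 1)) f ξ q (f q - r ^ 2) =
      {z | z ∈ D.cylDisc r ∧ sqSumLT D.k (D.coord z) = r ^ 2} := by
  have hdisc := h.leftHandDisc_eq_cylDisc hq D hD hr har
  ext x
  constructor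
  · rintro ⟨hxs, hfx⟩
    have hfx' : f x = f q - r ^ 2 := hfx
    have hxd : x ∈ D.cylDisc r := by
      rw [← hdisc]
      exact ⟨hxs, le_of_eq hfx'.symm⟩
    refine ⟨hxd, ?_⟩
    have := D.apply_eq_of_mem_source hxd.1
    rw [hxd.2.1, hfx'] at this
    linarith
  · rintro ⟨hxd, hA⟩
    have hx : x ∈ leftHandDisc (𝓡∂ (n + 1)) f ξ q (f q - r ^ 2) := hdisc ▸ hxd
    refine ⟨hx.1, ?_⟩
    show f x = f q - r ^ 2
    rw [D.apply_eq_of_mem_source hxd.1, hxd.2.1, hA]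
    ring

/-- **The left-hand disc down to the level `f(q) - r²` is the inverse-chart image of the model
disc `{y⃗ = 0, |x⃗|² ≤ r²}`** (same hypotheses). [cite: MilnorHCobordism1965, proof of Thm. 3.14 (PDF p. 19), Def. 3.9 (PDF p. 16)] -/
theorem leftHandDisc_eq_image_pt (h : SlabFlow c f ξ a₀ a₁ θ) {q : c.W}
    (hq : IsMCriticalPt (𝓡∂ (n + 1)) f q) (D : MilnorBox (𝓡∂ (n + 1)) f (slabField f ξ a₀ a₁) q)
    (hD : D.chart.source ⊆ f ⁻¹' Ioo a₀ a₁) {r : ℝ} (hr : r ^ 2 < D.ε ^ 2)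
    (har : a₀ ≤ f q - r ^ 2) :
    leftHandDisc (𝓡∂ (n + 1)) f ξ q (f q - r ^ 2) =
      D.pt '' {v | sqSumGE D.k v = 0 ∧ sqSumLT D.k v ≤ r ^ 2} := by
  rw [h.leftHandDisc_eq_cylDisc hq D hD hr har, D.cylDisc_eq_image_pt hr.le]

/-- **The left-hand disc down to the level `f(q) - r²` lies in the box** (`r² < ε²`,
`a₀ ≤ f(q) - r²`). [cite: MilnorHCobordism1965, proof of Thm. 3.14 (PDF p. 19)] -/
theorem leftHandDisc_subset_box (h : SlabFlow c f ξ a₀ a₁ θ) {q : c.W}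
    (hq : IsMCriticalPt (𝓡∂ (n + 1)) f q) (D : MilnorBox (𝓡∂ (n + 1)) f (slabField f ξ a₀ a₁) q)
    (hD : D.chart.source ⊆ f ⁻¹' Ioo a₀ a₁) {r : ℝ} (hr : r ^ 2 < D.ε ^ 2)
    (har : a₀ ≤ f q - r ^ 2) :
    leftHandDisc (𝓡∂ (n + 1)) f ξ q (f q - r ^ 2) ⊆ D.box := by
  rw [h.leftHandDisc_eq_cylDisc hq D hD hr har]
  exact fun z hz => D.mem_box_of_mem_cylDisc hr hz

end SlabFlow

end Cobordism

end Literature.Topology.FourManifolds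

end
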